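import Literature.NumberTheory.LFunctions.DirichletLTruncationBound
import Literature.NumberTheory.LFunctions.FeketePolyaKernelCertificates
import HarnessLib

/-!
# Kernel certificates for `L(σ, χ) > 0` on `[1/2, 1]` — hence no zero in `(0, 1)` — by the one-period
# truncation of the Dirichlet series with a second-order tail bound, evaluated in the kernel

Topic `Literature/NumberTheory/LFunctions`; namespace `Literature.NumberTheory.LFunctions.LTruncationCert`.
Small computable definitions (a bisection for integer roots, fixed-point enclosures, the cell walk, the
checker `certOK`) and THEOREMS (no named fact, no `sorry`).  Cell `parity-realchar` (kernel floor of the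
wide column: the EVEN wall `χ₄₃₇` — a real primitive character with `χ(p) = −1` for every prime `p ≤ 31`,
`p ∤ 437`, for which no Fekete–Pólya certificate of order `≤ 24` and modulus `≤ 3·10⁶` exists and whose theta
series `ϑ₀(y, χ)` is negative on `0.06 < y < 17`).

## The method (Davenport 1949 / Chua 2005, kernel form)

K. S. Chua, *Real zeros of Dedekind zeta functions of real quadratic fields*, Math. Comp. 74 (2005), §2:
`L(s, χ)` is positive on `[1/2, 1]` as soon as a one-period truncation `L_0(s, χ) = ∑_{n ≤ q} χ(n) n^{-s}`
dominates the remainder (Theorem 2.2), checked at finitely many `s` and propagated to intervals (Lemma 2.3,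
ALGO 1); the functional equation then excludes zeros in `(0, 1/2)`. [cite: Chua2005RealZeros, §2.2 ALGO 1]
The analytic half is the tree's `DirichletLTruncationBound.lean` (`LTruncation.lfunction_ne_zero_of_truncation`,
`LTruncation.cell_bound`).  This file supplies the arithmetic half, for a primitive quadratic `χ` mod `q` with
values `v : ℕ → ℤ` (`FeketePolyaKernel.valOdd/valFour/valEightA/valEightB`, MV Thm 9.13):

* `S(N) = ∑_{n ≤ N} v(n)`, `U(N) = ∑_{K ≤ N} S(K)` over one period, `B = max |U|`, and the check `U(q) = 0`
  (true for even `χ`) — `sums`, `Sv`, `Uv`, `sums_spec`;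
* `rootEnc n k P` — an enclosure `lo ≤ 2^P n^{-1/k} ≤ hi` by bisection on `r^k n ≤ 2^{kP}` (`bisect`,
  `rootEnc_spec`); `encPow` / `enc n J P m` — fixed-point enclosures of `2^P n^{-m/(2J)}` (`enc_spec`);
* cells `[s_j, s_j + 1/(2J)]`, `s_j = (J + j)/(2J)`, `j < J`, covering `[1/2, 1]`: in ONE pass over `n ≤ q`
  (`loop`, `cellStep`, `cellUpd`) the integers `a_j ≤ 2^P A_j(q)` and `d_j ≥ 4^P ∑_{N<q} max(0, −A_j(N))/N`,
  `A_j(N) = ∑_{n ≤ N} v(n) n^{-s_j}` (specification `aSpec`/`dSpec`, `loop_getElem?`, `aSpec_le`, `dSpec_ge`);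
* **`certOK v q J P`** — `q ≥ 7`, `J ≥ 1`, `S(q) = U(q) = 0`, and in every cell, with `ρ ≤ 2^P q^{-1/(2J)}`,
  `r² ≤ q + 1`:  `2·2J·(q+1)·r·a_j·ρ > 2(q+1)·r·d_j + 2J·4^P·B`, `a_j ≥ 0` — which is
  `A_j(q) q^{-1/(2J)} − D_j/(2J) > B/(2r(q+1)) ≥ B·((q+1)^{-σ} − (q+2)^{-σ})` (the tail), i.e. `L(σ, χ) > 0` on
  the cell by `cell_bound`;
* **`lfunction_ne_zero_of_certOK`** — soundness: `certOK v q J P = true ⇒ L(σ, χ) ≠ 0` for all `σ ∈ (0, 1)`;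
* `good_even_of_odd` / `good_even_of_four` / `good_even_of_eight` — per-conductor wrappers for EVEN characters
  keyed on `q` odd, `q = 4m`, `q = 8m` (parity test `valX (q−1) = −1` dismisses the odd character), the shape
  consumed by `interval_cases` range files (as `OddSmallModuliII.good_odd_of_*`).

Cost: one `decide +kernel` of `certOK (valOdd 437) 437 16 32` takes ≈ 6 s on the farm (437 bisections of
34 steps on 1024-bit integers, 16 cells); every even fundamental discriminant `436 < d ≤ 1100` passes with
`J = 16`, `P = 32` (integer model of this checker, cell seat notes), the worst margin being `d = 437` itself.

## References

* [Chua2005RealZeros] K. S. Chua, Math. Comp. 74 (2005) 1457–1470, §2 (Theorem 2.2, Lemma 2.3, ALGO 1).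
* [MontgomeryVaughan2007] H. L. Montgomery, R. C. Vaughan, *Multiplicative Number Theory I*, CUP 2007,
  §1.3 Thm 1.3, §9.3 Thm 9.13, §10.1.
* H. Davenport, *On the series for L(1)*, J. London Math. Soc. 24 (1949) 229–233 (Chua's [3]; context).
-/

namespace Literature.NumberTheory.LFunctions

namespace LTruncationCert

open Finset FeketePolyaKernel PrimitiveQuadratic LTruncation DirichletAbel

/-! ### Integer roots by bisection -/

/-- `bisect pred fuel lo hi`: bisection keeping `pred lo = true`, `pred hi = false`. [folklore] -/
def bisect (pred : ℕ → Bool) : ℕ → ℕ → ℕ → ℕ × ℕ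
  | 0, xl, xh => (xl, xh)
  | fuel + 1, xl, xh =>
    if xl + 1 < xh then
      (if pred ((xl + xh) / 2) then bisect pred fuel ((xl + xh) / 2) xh
        else bisect pred fuel xl ((xl + xh) / 2))
    else (xl, xh)

/-- The bisection invariant. [folklore] -/
private theorem bisect_spec (pred : ℕ → Bool) : ∀ (fuel xl xh : ℕ), pred xl = true → pred xh = false →
    pred (bisect pred fuel xl xh).1 = true ∧ pred (bisect pred fuel xl xh).2 = false := by
  intro fuel
  induction fuel with
  | zero => intro xl xh h1 h2; exact ⟨h1, h2⟩
  | succ fuel ih =>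
    intro xl xh h1 h2
    simp only [bisect]
    split_ifs with hlt hmid
    · exact ih _ _ hmid h2
    · exact ih _ _ h1 (by simpa using hmid)
    · exact ⟨h1, h2⟩

/-- `rootPred n k P r := [r^k · n ≤ (2^P)^k]`, i.e. `r/2^P ≤ n^{-1/k}`. [folklore] -/
def rootPred (n k P r : ℕ) : Bool := decide (r ^ k * n ≤ (2 ^ P) ^ k)

/-- `rootEnc n k P = (lo, hi)` with `lo/2^P ≤ n^{-1/k} ≤ hi/2^P` (`n, k ≥ 1`). [folklore] -/
def rootEnc (n k P : ℕ) : ℕ × ℕ := bisect (rootPred n k P) (P + 2) 0 (2 ^ P + 1)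

/-- `encPow lo hi ONE m = (lo_m, hi_m)`: fixed-point enclosure of the `m`-th power of a number enclosed
by `[lo, hi]/ONE` (products rounded down / up). [folklore] -/
def encPow (lo hi ONE : ℕ) : ℕ → ℕ × ℕ
  | 0 => (ONE, ONE)
  | m + 1 => ((encPow lo hi ONE m).1 * lo / ONE, ((encPow lo hi ONE m).2 * hi + ONE - 1) / ONE)

/-- `enc n J P m`: enclosure of `2^P · n^{-m/(2J)}`. [folklore] -/
def enc (n J P m : ℕ) : ℕ × ℕ := encPow (rootEnc n (2 * J) P).1 (rootEnc n (2 * J) P).2 (2 ^ P) m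

/-! ### The cells -/

/-- Contribution of the `n`-th term to the lower bound of a partial sum: `+lo` for `χ(n) = 1`,
`−hi` for `χ(n) = −1`, `0` for `χ(n) = 0`. [folklore] -/
def contrib (vn : ℤ) (lo hi : ℕ) : ℤ := if vn = 1 then (lo : ℤ) else if vn = -1 then -(hi : ℤ) else 0

/-- One cell update: `a ← a + contrib`, and if `n < q`, `a < 0`: `d ← d + ⌈(−a)·ONE/n⌉`. [folklore] -/
def cellUpd (vn : ℤ) (n q ONE lo hi : ℕ) (c : ℤ × ℕ) : ℤ × ℕ :=
  (c.1 + contrib vn lo hi,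
    if n < q ∧ c.1 + contrib vn lo hi < 0 then
      c.2 + ((-(c.1 + contrib vn lo hi)).toNat * ONE + n - 1) / n else c.2)

/-- Walk the cells `j = 0, 1, …` with the enclosure `(lo, hi)` of `2^P n^{-s_j}` stepping by the root
enclosure `(rlo, rhi)` of `2^P n^{-1/(2J)}`. [folklore] -/
def cellStep (vn : ℤ) (n q ONE rlo rhi : ℕ) : List (ℤ × ℕ) → ℕ → ℕ → List (ℤ × ℕ)
  | [], _, _ => []
  | c :: rest, xl, xh =>
    cellUpd vn n q ONE xl xh c :: cellStep vn n q ONE rlo rhi rest (xl * rlo / ONE) ((xh * rhi + ONE - 1) / ONE)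

/-- The main pass over `n = t+1, …, t+fuel`. [folklore] -/
def loop (v : ℕ → ℤ) (q J P : ℕ) : ℕ → ℕ → List (ℤ × ℕ) → List (ℤ × ℕ)
  | 0, _, cells => cells
  | fuel + 1, t, cells =>
    loop v q J P fuel (t + 1)
      (cellStep (v (t + 1)) (t + 1) q (2 ^ P) (rootEnc (t + 1) (2 * J) P).1 (rootEnc (t + 1) (2 * J) P).2
        cells (enc (t + 1) J P J).1 (enc (t + 1) J P J).2)

/-- First and second running sums `S`, `U` of `v` over `n = t+1, …, t+fuel` with `max |U|`. [folklore] -/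
def sums (v : ℕ → ℤ) : ℕ → ℕ → ℤ → ℤ → ℕ → ℤ × ℤ × ℕ
  | 0, _, s, u, B => (s, u, B)
  | fuel + 1, t, s, u, B =>
    sums v fuel (t + 1) (s + v (t + 1)) (u + (s + v (t + 1))) (max B (u + (s + v (t + 1))).natAbs)

/-- Lower integer square root of `q + 1` by bisection. [folklore] -/
def isqrtSucc (q : ℕ) : ℕ := (bisect (fun r ↦ decide (r * r ≤ q + 1)) (q + 2) 0 (q + 2)).1

/-- **The certificate.** `certOK v q J P`: with `J` cells `[s_j, s_j + 1/(2J)]`, `s_j = (J+j)/(2J)`, covering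
`[1/2, 1]`, precision `2^{-P}`: `S(q) = U(q) = 0`, and in every cell
`2·2J·(q+1)·r·a_j·ρ − 2(q+1)·r·d_j − 2J·4^P·B > 0` with `a_j ≥ 0`, where `a_j/2^P ≤ A_j(q)`,
`d_j/4^P ≥ ∑_{N<q} max(0, −A_j(N))/N`, `ρ/2^P ≤ q^{−1/(2J)}`, `r² ≤ q+1`, `B = max_N |U(N)|`.
[cite: Chua2005RealZeros, §2.2 ALGO 1] -/
def certOK (v : ℕ → ℤ) (q J P : ℕ) : Bool :=
  let su := sums v q 0 0 0 0
  let cells := loop v q J P q 0 (List.replicate J ((0 : ℤ), (0 : ℕ)))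
  let ρ := (rootEnc q (2 * J) P).1
  let r := isqrtSucc q
  decide (7 ≤ q) && decide (0 < J) && decide (su.1 = 0) && decide (su.2.1 = 0) && decide (0 < r) &&
    cells.all (fun c ↦ decide (0 ≤ c.1) &&
      decide (2 * J * (2 ^ P * 2 ^ P) * su.2.2 + 2 * (q + 1) * r * c.2 <
        2 * (2 * J) * (q + 1) * r * c.1.toNat * ρ))


/-! ## Soundness -/

section Soundness

/-! ### Roots and fixed-point powers -/

/-- For `n, k ≥ 1`: `lo ≤ 2^P n^{-1/k} ≤ hi` where `(lo, hi) = rootEnc n k P` (the rigorous evaluation step of the algorithm). [cite: Chua2005RealZeros, §2.2 ALGO 1] -/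
theorem rootEnc_spec {n k : ℕ} (P : ℕ) (hn : 1 ≤ n) (hk : 1 ≤ k) :
    ((rootEnc n k P).1 : ℝ) ≤ (2 ^ P : ℝ) * (n : ℝ) ^ (-(1 / (k : ℝ))) ∧
      (2 ^ P : ℝ) * (n : ℝ) ^ (-(1 / (k : ℝ))) ≤ ((rootEnc n k P).2 : ℝ) := by
  have hk0 : k ≠ 0 := by omega
  have h0 : rootPred n k P 0 = true := by simp [rootPred, zero_pow hk0]
  have h1 : rootPred n k P (2 ^ P + 1) = false := by
    simp only [rootPred, decide_eq_false_iff_not, not_le]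
    calc (2 ^ P) ^ k < (2 ^ P + 1) ^ k := Nat.pow_lt_pow_left (by omega) hk0
      _ = (2 ^ P + 1) ^ k * 1 := (mul_one _).symm
      _ ≤ (2 ^ P + 1) ^ k * n := Nat.mul_le_mul_left _ hn
  obtain ⟨hlo, hhi⟩ := bisect_spec (rootPred n k P) (P + 2) 0 (2 ^ P + 1) h0 h1
  rw [rootEnc]
  set lo := (bisect (rootPred n k P) (P + 2) 0 (2 ^ P + 1)).1
  set hi := (bisect (rootPred n k P) (P + 2) 0 (2 ^ P + 1)).2
  simp only [rootPred, decide_eq_true_eq, decide_eq_false_iff_not, not_le] at hlo hhi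
  have hn0 : (0 : ℝ) < n := by exact_mod_cast hn
  set y : ℝ := (n : ℝ) ^ (-(1 / (k : ℝ))) with hy
  have hy0 : 0 < y := Real.rpow_pos_of_pos hn0 _
  have hyk : y ^ k = (n : ℝ)⁻¹ := by
    rw [hy, ← Real.rpow_natCast, ← Real.rpow_mul hn0.le]
    rw [show -(1 / (k : ℝ)) * k = -1 by field_simp]
    exact Real.rpow_neg_one _
  have hYk : ((2 : ℝ) ^ P * y) ^ k = ((2 ^ P) ^ k : ℝ) / n := by
    rw [mul_pow, hyk, div_eq_mul_inv]
  have hY0 : 0 ≤ (2 : ℝ) ^ P * y := by positivity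
  constructor
  · rw [← pow_le_pow_iff_left₀ (by positivity) hY0 hk0, hYk, le_div_iff₀ hn0]
    exact_mod_cast hlo
  · rw [← pow_le_pow_iff_left₀ hY0 (by positivity) hk0, hYk, div_le_iff₀ hn0]
    exact_mod_cast hhi.le

/-- Rounding up: `A/ONE ≤ ⌈A/ONE⌉ = (A + ONE − 1)/ONE` (naturals). [folklore] -/
private theorem div_le_ceilDiv {A ONE : ℕ} (hONE : 0 < ONE) :
    (A : ℝ) / ONE ≤ (((A + ONE - 1) / ONE : ℕ) : ℝ) := by
  have h := Nat.lt_div_mul_add (a := A + ONE - 1) hONE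
  have key : ∀ M : ℕ, A + ONE - 1 < M + ONE → A ≤ M := by intro M hM; omega
  have h2 : A ≤ (A + ONE - 1) / ONE * ONE := key _ h
  have hO : (0 : ℝ) < ONE := by exact_mod_cast hONE
  rw [div_le_iff₀ hO]
  exact_mod_cast h2

/-- The fixed-point powers enclose the powers (rigorous evaluation of `n^{-s}` at the grid exponents). [cite: Chua2005RealZeros, §2.2 ALGO 1] -/
theorem encPow_spec {xl xh ONE : ℕ} (hONE : 0 < ONE) {y : ℝ} (hy : 0 ≤ y)
    (hl : (xl : ℝ) ≤ ONE * y) (hh : (ONE : ℝ) * y ≤ xh) :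
    ∀ m : ℕ, ((encPow xl xh ONE m).1 : ℝ) ≤ ONE * y ^ m ∧ (ONE : ℝ) * y ^ m ≤ ((encPow xl xh ONE m).2 : ℝ) := by
  have hO : (0 : ℝ) < ONE := by exact_mod_cast hONE
  intro m
  induction m with
  | zero => simp [encPow]
  | succ m ih =>
    obtain ⟨ih1, ih2⟩ := ih
    simp only [encPow]
    constructor
    · calc (((encPow xl xh ONE m).1 * xl / ONE : ℕ) : ℝ) ≤ ((encPow xl xh ONE m).1 * xl : ℕ) / (ONE : ℝ) :=
          Nat.cast_div_le
        _ ≤ ONE * y ^ m * (ONE * y) / ONE := by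
          push_cast
          exact div_le_div_of_nonneg_right (mul_le_mul ih1 hl (Nat.cast_nonneg _) (by positivity)) hO.le
        _ = ONE * y ^ (m + 1) := by field_simp; ring
    · calc (ONE : ℝ) * y ^ (m + 1) = ONE * y ^ m * (ONE * y) / ONE := by field_simp; ring
        _ ≤ ((encPow xl xh ONE m).2 * xh : ℕ) / (ONE : ℝ) := by
          push_cast
          exact div_le_div_of_nonneg_right (mul_le_mul ih2 hh (by positivity) (Nat.cast_nonneg _)) hO.le
        _ ≤ ((((encPow xl xh ONE m).2 * xh + ONE - 1) / ONE : ℕ) : ℝ) := div_le_ceilDiv hONE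

/-- Enclosure of `2^P n^{-m/(2J)}`; the exponent of cell `j` is `s_j = (J + j)/(2J) = 1/2 + j/(2J)`. [cite: Chua2005RealZeros, §2.2 ALGO 1] -/
theorem enc_spec {n J : ℕ} (P m : ℕ) (hn : 1 ≤ n) (hJ : 1 ≤ J) :
    ((enc n J P m).1 : ℝ) ≤ (2 ^ P : ℝ) * (n : ℝ) ^ (-((m : ℝ) / ((2 * J : ℕ) : ℝ))) ∧
      (2 ^ P : ℝ) * (n : ℝ) ^ (-((m : ℝ) / ((2 * J : ℕ) : ℝ))) ≤ ((enc n J P m).2 : ℝ) := by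
  have hn0 : (0 : ℝ) < n := by exact_mod_cast hn
  obtain ⟨hl, hh⟩ := rootEnc_spec P hn (show 1 ≤ 2 * J by omega)
  set y : ℝ := (n : ℝ) ^ (-(1 / ((2 * J : ℕ) : ℝ)))
  have hy : 0 ≤ y := (Real.rpow_pos_of_pos hn0 _).le
  have hpow : (n : ℝ) ^ (-((m : ℝ) / ((2 * J : ℕ) : ℝ))) = y ^ m := by
    rw [← Real.rpow_natCast, ← Real.rpow_mul hn0.le]
    congr 1; ring
  have h := encPow_spec (ONE := 2 ^ P) (by positivity) hy (by exact_mod_cast hl) (by exact_mod_cast hh) m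
  rw [enc, hpow]
  exact_mod_cast h

/-! ### The cells: specification of what `loop` computes -/

variable (v : ℕ → ℤ) (q J P : ℕ)

/-- Spec: the lower accumulator of cell `j` after `N` terms. [folklore] -/
def aSpec (j : ℕ) : ℕ → ℤ
  | 0 => 0
  | N + 1 => aSpec j N + contrib (v (N + 1)) (enc (N + 1) J P (J + j)).1 (enc (N + 1) J P (J + j)).2

/-- Spec: the `D`-accumulator of cell `j` after `N` terms. [folklore] -/
def dSpec (j : ℕ) : ℕ → ℕ
  | 0 => 0
  | N + 1 =>
    if N + 1 < q ∧ aSpec v J P j (N + 1) < 0 then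
      dSpec j N + ((-aSpec v J P j (N + 1)).toNat * 2 ^ P + (N + 1) - 1) / (N + 1)
    else dSpec j N

/-- One `cellUpd` from the spec state is the next spec state. [folklore] -/
private theorem cellUpd_spec (j N : ℕ) :
    cellUpd (v (N + 1)) (N + 1) q (2 ^ P) (enc (N + 1) J P (J + j)).1 (enc (N + 1) J P (J + j)).2
      (aSpec v J P j N, dSpec v q J P j N) = (aSpec v J P j (N + 1), dSpec v q J P j (N + 1)) := by
  simp only [cellUpd, aSpec, dSpec]

/-- `cellStep` acts on the `i`-th cell with the enclosure of index `m + i`. [folklore] -/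
private theorem cellStep_getElem? (vn : ℤ) (n : ℕ) : ∀ (cells : List (ℤ × ℕ)) (m i : ℕ),
    (cellStep vn n q (2 ^ P) (rootEnc n (2 * J) P).1 (rootEnc n (2 * J) P).2 cells
        (enc n J P m).1 (enc n J P m).2)[i]? =
      cells[i]?.map (cellUpd vn n q (2 ^ P) (enc n J P (m + i)).1 (enc n J P (m + i)).2) := by
  intro cells
  induction cells with
  | nil => intro m i; simp [cellStep]
  | cons c rest ih =>
    intro m i
    have hstep : ((enc n J P m).1 * (rootEnc n (2 * J) P).1 / 2 ^ P,
        ((enc n J P m).2 * (rootEnc n (2 * J) P).2 + 2 ^ P - 1) / 2 ^ P) = enc n J P (m + 1) := by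
      simp only [enc, encPow]
    cases i with
    | zero => simp [cellStep]
    | succ i =>
      simp only [cellStep, List.getElem?_cons_succ]
      rw [show (enc n J P m).1 * (rootEnc n (2 * J) P).1 / 2 ^ P = (enc n J P (m + 1)).1 from
        congrArg Prod.fst hstep, show ((enc n J P m).2 * (rootEnc n (2 * J) P).2 + 2 ^ P - 1) / 2 ^ P =
        (enc n J P (m + 1)).2 from congrArg Prod.snd hstep, ih (m + 1) i, show m + 1 + i = m + (i + 1) by ring]

/-- `loop` computes the spec states of all cells (one pass of the algorithm over `n ≤ q`). [cite: Chua2005RealZeros, §2.2 ALGO 1] -/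
theorem loop_getElem? : ∀ (fuel t : ℕ) (cells : List (ℤ × ℕ)),
    (∀ j, j < J → cells[j]? = some (aSpec v J P j t, dSpec v q J P j t)) →
      ∀ j, j < J → (loop v q J P fuel t cells)[j]? =
        some (aSpec v J P j (t + fuel), dSpec v q J P j (t + fuel)) := by
  intro fuel
  induction fuel with
  | zero => intro t cells h j hj; simp only [loop, Nat.add_zero]; exact h j hj
  | succ fuel ih =>
    intro t cells h j hj
    simp only [loop]
    rw [show t + (fuel + 1) = (t + 1) + fuel by ring]
    refine ih (t + 1) _ (fun j' hj' ↦ ?_) j hj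
    rw [cellStep_getElem? q J P, h j' hj', Option.map_some, cellUpd_spec]

/-! ### Analytic meaning of the cell states -/

/-- The accumulator `a_j` is a lower bound: `a_j(N) ≤ 2^P A_j(N)`, `A_j(N) = ∑_{n ≤ N} v(n) n^{-s_j}`, `s_j = (J+j)/(2J)` (rigorous lower bound for `L_0` at the grid point). [cite: Chua2005RealZeros, §2.2 ALGO 1] -/
theorem aSpec_le (hJ : 1 ≤ J) (hv : ∀ n, v n = 0 ∨ v n = 1 ∨ v n = -1) (j : ℕ) : ∀ N : ℕ,
    (aSpec v J P j N : ℝ) ≤ (2 ^ P : ℝ) * ∑ n ∈ range N,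
      (v (n + 1) : ℝ) * ((n + 1 : ℕ) : ℝ) ^ (-(((J + j : ℕ) : ℝ) / ((2 * J : ℕ) : ℝ))) := by
  intro N
  induction N with
  | zero => simp [aSpec]
  | succ N ih =>
    rw [aSpec, Finset.sum_range_succ, mul_add, Int.cast_add (aSpec v J P j N)]
    refine add_le_add ih ?_
    obtain ⟨h1, h2⟩ := enc_spec P (J + j) (show 1 ≤ N + 1 by omega) hJ
    set z : ℝ := ((N + 1 : ℕ) : ℝ) ^ (-(((J + j : ℕ) : ℝ) / ((2 * J : ℕ) : ℝ))) with hz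
    rcases hv (N + 1) with h | h | h
    · simp [contrib, h]
    · simp only [contrib, h, if_true, Int.cast_natCast, Int.cast_one, one_mul]; exact h1
    · simp only [contrib, h, show ¬((-1 : ℤ) = 1) by decide, if_false, if_true, Int.cast_neg,
        Int.cast_natCast, Int.cast_one, neg_one_mul, mul_neg]
      exact neg_le_neg h2

/-- The `D`-accumulator dominates `4^P ∑_{N < min(t, q−1)} max(0, −A_j(N+1))/(N+1)` (the interval-propagation data). [cite: Chua2005RealZeros, §2.2 Lemma 2.3] -/
theorem dSpec_ge (hJ : 1 ≤ J) (hv : ∀ n, v n = 0 ∨ v n = 1 ∨ v n = -1) (j : ℕ) : ∀ t : ℕ,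
    (2 ^ P : ℝ) * 2 ^ P * ∑ i ∈ range (min t (q - 1)),
        max 0 (-(∑ n ∈ range (i + 1), (v (n + 1) : ℝ) *
          ((n + 1 : ℕ) : ℝ) ^ (-(((J + j : ℕ) : ℝ) / ((2 * J : ℕ) : ℝ))))) / ((i + 1 : ℕ) : ℝ)
      ≤ (dSpec v q J P j t : ℝ) := by
  intro t
  induction t with
  | zero => simp [dSpec]
  | succ t ih =>
    have hA := aSpec_le v J P hJ hv j (t + 1)
    set A := ∑ n ∈ range (t + 1), (v (n + 1) : ℝ) *
      ((n + 1 : ℕ) : ℝ) ^ (-(((J + j : ℕ) : ℝ) / ((2 * J : ℕ) : ℝ))) with hAdef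
    by_cases htq : t + 1 < q
    · have hmin : min (t + 1) (q - 1) = min t (q - 1) + 1 := by omega
      rw [hmin, Finset.sum_range_succ, mul_add, show min t (q - 1) = t by omega]
      rw [show min t (q - 1) = t by omega] at ih
      rw [dSpec]
      by_cases ha : aSpec v J P j (t + 1) < 0
      · rw [if_pos ⟨htq, ha⟩, Nat.cast_add (dSpec v q J P j t)]
        refine add_le_add ih ?_
        -- `4^P max(0,-A)/(t+1) ≤ 2^P (-a)/(t+1) ≤ ⌈(-a) 2^P/(t+1)⌉`
        have hna : (0 : ℝ) ≤ -(aSpec v J P j (t + 1) : ℝ) := by exact_mod_cast (by omega : (0:ℤ) ≤ -aSpec v J P j (t + 1))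
        have hmax : max 0 (-A) ≤ -(aSpec v J P j (t + 1) : ℝ) / 2 ^ P := by
          refine max_le (by positivity) ?_
          rw [le_div_iff₀ (by positivity)]; linarith
        have ht0 : (0 : ℝ) < ((t + 1 : ℕ) : ℝ) := by positivity
        have hcast : (((-aSpec v J P j (t + 1)).toNat : ℕ) : ℝ) = -(aSpec v J P j (t + 1) : ℝ) := by
          have : (((-aSpec v J P j (t + 1)).toNat : ℕ) : ℤ) = -aSpec v J P j (t + 1) := Int.toNat_of_nonneg (by omega)
          exact_mod_cast this
        calc (2 ^ P : ℝ) * 2 ^ P * (max 0 (-A) / ((t + 1 : ℕ) : ℝ))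
            ≤ (2 ^ P : ℝ) * 2 ^ P * ((-(aSpec v J P j (t + 1) : ℝ) / 2 ^ P) / ((t + 1 : ℕ) : ℝ)) := by
              gcongr
          _ = ((((-aSpec v J P j (t + 1)).toNat * 2 ^ P : ℕ)) : ℝ) / ((t + 1 : ℕ) : ℝ) := by
              push_cast; rw [hcast]; field_simp
          _ ≤ (((((-aSpec v J P j (t + 1)).toNat * 2 ^ P + (t + 1) - 1) / (t + 1) : ℕ)) : ℝ) :=
              div_le_ceilDiv (by omega)
      · rw [if_neg (fun h ↦ ha h.2)]
        have hA0 : 0 ≤ A := by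
          have : (0 : ℝ) ≤ (aSpec v J P j (t + 1) : ℝ) := by exact_mod_cast (not_lt.mp ha)
          nlinarith [show (0:ℝ) < 2 ^ P by positivity]
        rw [max_eq_left (by linarith), zero_div, mul_zero, add_zero]
        exact ih
    · have hmin : min (t + 1) (q - 1) = min t (q - 1) := by omega
      rw [hmin, dSpec, if_neg (fun h ↦ htq h.1)]
      exact ih


/-! ### Running sums and the bridge to `partialSum χ` -/

/-- `S(N) = ∑_{n ≤ N} v(n)`. [folklore] -/
def Sv : ℕ → ℤ
  | 0 => 0
  | n + 1 => Sv n + v (n + 1)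

/-- `U(N) = ∑_{K ≤ N} S(K)`. [folklore] -/
def Uv : ℕ → ℤ
  | 0 => 0
  | n + 1 => Uv n + Sv v (n + 1)

/-- Invariant of `sums`: `S`, `U` and `max |U|` over one period (the data of the remainder bound). [cite: Chua2005RealZeros, Theorem 2.2] -/
theorem sums_spec : ∀ (fuel t B : ℕ), (∀ j, j ≤ t → (Uv v j).natAbs ≤ B) →
    (sums v fuel t (Sv v t) (Uv v t) B).1 = Sv v (t + fuel) ∧
      (sums v fuel t (Sv v t) (Uv v t) B).2.1 = Uv v (t + fuel) ∧
        ∀ j, j ≤ t + fuel → (Uv v j).natAbs ≤ (sums v fuel t (Sv v t) (Uv v t) B).2.2 := by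
  intro fuel
  induction fuel with
  | zero => intro t B hB; exact ⟨by simp [sums], by simp [sums], by simpa [sums] using hB⟩
  | succ fuel ih =>
    intro t B hB
    have h1 : Sv v t + v (t + 1) = Sv v (t + 1) := by simp [Sv]
    have h2 : Uv v t + (Sv v t + v (t + 1)) = Uv v (t + 1) := by simp [Uv, Sv]
    simp only [sums]
    rw [h2, h1]
    have hB' : ∀ j, j ≤ t + 1 → (Uv v j).natAbs ≤ max B (Uv v (t + 1)).natAbs := by
      intro j hj
      rcases Nat.lt_or_ge j (t + 1) with hlt | hge
      · exact (hB j (by omega)).trans (le_max_left _ _)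
      · rw [show j = t + 1 by omega]; exact le_max_right _ _
    obtain ⟨e1, e2, e3⟩ := ih (t + 1) _ hB'
    exact ⟨by rw [e1, show t + 1 + fuel = t + (fuel + 1) by ring],
      by rw [e2, show t + 1 + fuel = t + (fuel + 1) by ring],
      fun j hj ↦ e3 j (by omega)⟩

variable {v} {q}
variable [NeZero q] {χ : DirichletCharacter ℂ q}

omit [NeZero q] in
/-- A quadratic character with `ℜχ = v` takes the values `v(n) ∈ {0, 1, −1}`. [folklore] -/
private theorem val_trichotomy (hquad : χ.IsQuadratic) (hv : ∀ n : ℕ, (χ (n : ZMod q)).re = v n) (n : ℕ) :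
    v n = 0 ∨ v n = 1 ∨ v n = -1 := by
  have h := hv n
  rcases hquad (n : ZMod q) with h0 | h1 | h2
  · rw [h0, Complex.zero_re] at h; left; exact_mod_cast h.symm
  · rw [h1, Complex.one_re] at h; right; left; exact_mod_cast h.symm
  · rw [h2, Complex.neg_re, Complex.one_re] at h; right; right; exact_mod_cast h.symm

omit [NeZero q] in
/-- `χ(n) = v(n)` as complex numbers (the values of a quadratic character are real). [folklore] -/
private theorem apply_eq_val (hquad : χ.IsQuadratic) (hv : ∀ n : ℕ, (χ (n : ZMod q)).re = v n) (n : ℕ) :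
    χ (n : ZMod q) = ((v n : ℤ) : ℂ) := by
  apply Complex.ext
  · rw [hv n]; norm_cast
  · rw [DirichletAbel.apply_im_eq_zero χ hquad.sq_eq_one]; norm_cast

omit [NeZero q] in
/-- `S(N) = partialSum χ N`. [folklore] -/
private theorem partialSum_eq_Sv (hquad : χ.IsQuadratic) (hv : ∀ n : ℕ, (χ (n : ZMod q)).re = v n) :
    ∀ N : ℕ, partialSum χ N = ((Sv v N : ℤ) : ℂ) := by
  intro N
  induction N with
  | zero => simp [Sv]
  | succ N ih => rw [partialSum_succ, ih, apply_eq_val hquad hv, Sv]; push_cast; ring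

omit [NeZero q] in
/-- `U(N) = ∑_{k<N} partialSum χ (k+1)`. [folklore] -/
private theorem sum_partialSum_eq_Uv (hquad : χ.IsQuadratic) (hv : ∀ n : ℕ, (χ (n : ZMod q)).re = v n) :
    ∀ N : ℕ, ∑ k ∈ range N, partialSum χ (k + 1) = ((Uv v N : ℤ) : ℂ) := by
  intro N
  induction N with
  | zero => simp [Uv]
  | succ N ih => rw [Finset.sum_range_succ, ih, partialSum_eq_Sv hquad hv, Uv]; push_cast; ring

/-! ### Locating `σ ∈ [1/2, 1]` in a cell -/

omit [NeZero q] in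
/-- Every `σ ∈ [1/2, 1]` lies in some cell `[s_j, s_j + 1/(2J)]`, `s_j = (J + j)/(2J)`, `j < J` (the grid of ALGO 1). [cite: Chua2005RealZeros, §2.2 ALGO 1] -/
theorem exists_cell {J : ℕ} (hJ : 1 ≤ J) {σ : ℝ} (h1 : 1 / 2 ≤ σ) (h2 : σ ≤ 1) :
    ∃ j : ℕ, j < J ∧ ∃ u : ℝ, 0 ≤ u ∧ u ≤ 1 / ((2 * J : ℕ) : ℝ) ∧
      σ = ((J + j : ℕ) : ℝ) / ((2 * J : ℕ) : ℝ) + u := by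
  have hJ0 : (0 : ℝ) < J := by exact_mod_cast hJ
  set tt : ℝ := (2 * σ - 1) * J with htt
  have htt0 : 0 ≤ tt := by rw [htt]; nlinarith
  have httJ : tt ≤ J := by rw [htt]; nlinarith
  set jj : ℕ := min (J - 1) ⌊tt⌋₊ with hjj
  have hjlo : (jj : ℝ) ≤ tt := le_trans (by exact_mod_cast (min_le_right _ _)) (Nat.floor_le htt0)
  have hjhi : tt ≤ (jj : ℝ) + 1 := by
    rcases le_total ⌊tt⌋₊ (J - 1) with hle | hle
    · rw [hjj, min_eq_right hle]; exact (Nat.lt_floor_add_one tt).le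
    · rw [hjj, min_eq_left hle]
      have : ((J - 1 : ℕ) : ℝ) + 1 = J := by rw [Nat.cast_sub hJ]; push_cast; ring
      rw [this]; exact httJ
  have hc1 : ((J + jj : ℕ) : ℝ) = (J : ℝ) + jj := by push_cast; ring
  have hc2 : ((2 * J : ℕ) : ℝ) = 2 * (J : ℝ) := by push_cast; ring
  refine ⟨jj, by omega, σ - ((J + jj : ℕ) : ℝ) / ((2 * J : ℕ) : ℝ), ?_, ?_, by ring⟩
  · rw [hc1, hc2, sub_nonneg, div_le_iff₀ (by positivity)]
    rw [htt] at hjlo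
    nlinarith
  · rw [hc1, hc2, sub_le_iff_le_add, ← add_div, le_div_iff₀ (by positivity)]
    rw [htt] at hjhi
    nlinarith

/-! ### The main theorem -/

/-- **Soundness of the certificate.** For a primitive quadratic `χ` mod `q` with `ℜχ(n) = v(n)`:
`certOK v q J P = true ⇒ L(σ, χ) ≠ 0` for every `σ ∈ (0, 1)` — the truncation bound, cell by cell on
`[1/2, 1]` (`DirichletLTruncationBound.lean`), then reflection to `(0, 1/2)`.
[cite: Chua2005RealZeros, §2.2 ALGO 1] -/
theorem lfunction_ne_zero_of_certOK (hprim : χ.IsPrimitive) (hquad : χ.IsQuadratic)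
    (hv : ∀ n : ℕ, (χ (n : ZMod q)).re = v n) {J P : ℕ} (hcert : certOK v q J P = true) :
    ∀ σ : ℝ, 0 < σ → σ < 1 → χ.LFunction (σ : ℂ) ≠ 0 := by
  simp only [certOK, Bool.and_eq_true, decide_eq_true_eq, List.all_eq_true] at hcert
  obtain ⟨⟨⟨⟨⟨hq7, hJ⟩, -⟩, hU0⟩, hr⟩, hcells⟩ := hcert
  have hJ1 : 1 ≤ J := hJ
  have hv3 := val_trichotomy hquad hv
  -- the running sums
  obtain ⟨-, e2, e3⟩ := sums_spec v q 0 0 (fun j hj ↦ by rw [show j = 0 by omega]; simp [Uv])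
  simp only [Sv, Uv, zero_add] at e2 e3
  set B₂ : ℕ := (sums v q 0 0 0 0).2.2 with hB₂
  rw [e2] at hU0
  have hUq : ∑ k ∈ range q, partialSum χ (k + 1) = 0 := by
    rw [sum_partialSum_eq_Uv hquad hv, hU0]; simp
  have hU : ∀ N, N < q → ‖∑ k ∈ range N, partialSum χ (k + 1)‖ ≤ (B₂ : ℝ) := by
    intro N hN
    rw [sum_partialSum_eq_Uv hquad hv, Complex.norm_intCast, ← Int.cast_abs]
    have := e3 N hN.le
    have h' : |Uv v N| ≤ (B₂ : ℤ) := by rw [Int.abs_eq_natAbs]; exact_mod_cast this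
    exact_mod_cast h'
  -- `r = isqrtSucc q`: `r² ≤ q + 1`
  have hrq : isqrtSucc q * isqrtSucc q ≤ q + 1 := by
    have := (bisect_spec (fun r ↦ decide (r * r ≤ q + 1)) (q + 2) 0 (q + 2) (by simp)
      (by simp only [decide_eq_false_iff_not, not_le]; nlinarith)).1
    simpa [isqrtSucc] using this
  set r := isqrtSucc q with hrdef
  have hχ1 : χ ≠ 1 := SelbergDirichlet.ne_one_of_isPrimitive (by omega) hprim
  refine LTruncation.lfunction_ne_zero_of_truncation χ hprim hχ1 hq7 hUq hU hr hrq fun σ hσ1 hσ2 ↦ ?_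
  -- choose the cell
  obtain ⟨j, hjJ, u, hu0, huh, hσ⟩ := exists_cell hJ1 hσ1 hσ2
  set s₀ : ℝ := ((J + j : ℕ) : ℝ) / ((2 * J : ℕ) : ℝ) with hs₀
  -- the cell state computed by `loop`
  have hinit : ∀ j', j' < J → (List.replicate J ((0 : ℤ), (0 : ℕ)))[j']? =
      some (aSpec v J P j' 0, dSpec v q J P j' 0) := fun j' hj' ↦ by
    rw [List.getElem?_replicate, if_pos hj']; rfl
  have hget := loop_getElem? v q J P q 0 _ hinit j hjJ
  simp only [zero_add] at hget
  obtain ⟨ha0, hineq⟩ := hcells _ (List.mem_of_getElem? hget)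
  simp only at ha0 hineq
  set a : ℤ := aSpec v J P j q with hadef
  set d : ℕ := dSpec v q J P j q with hddef
  set ρ : ℕ := (rootEnc q (2 * J) P).1 with hρdef
  -- real quantities
  set A : ℝ := ∑ n ∈ range q, (v (n + 1) : ℝ) * ((n + 1 : ℕ) : ℝ) ^ (-s₀) with hAdef
  set D : ℝ := ∑ i ∈ range (q - 1), max 0 (-(∑ n ∈ range (i + 1), (v (n + 1) : ℝ) *
      ((n + 1 : ℕ) : ℝ) ^ (-s₀))) / ((i + 1 : ℕ) : ℝ) with hDdef
  set qu : ℝ := ((q : ℕ) : ℝ) ^ (-u) with hqu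
  have hq0 : (0 : ℝ) < q := by exact_mod_cast (show 0 < q by omega)
  have h2P : (0 : ℝ) < 2 ^ P := by positivity
  -- (1) `a ≤ 2^P A`, `a ≥ 0`
  have h1 : (a : ℝ) ≤ 2 ^ P * A := aSpec_le v J P hJ1 hv3 j q
  have ha0' : (0 : ℝ) ≤ a := by exact_mod_cast ha0
  -- (2) `4^P D ≤ d`
  have h2 : (2 ^ P : ℝ) * 2 ^ P * D ≤ d := by
    have := dSpec_ge v q J P hJ1 hv3 j q
    rwa [show min q (q - 1) = q - 1 by omega] at this
  -- (3) `ρ ≤ 2^P q^{-1/(2J)} ≤ 2^P qu`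
  have h3 : (ρ : ℝ) ≤ 2 ^ P * qu := by
    have hρ := (rootEnc_spec P (show 1 ≤ q by omega) (show 1 ≤ 2 * J by omega)).1
    refine hρ.trans (mul_le_mul_of_nonneg_left ?_ h2P.le)
    rw [hqu]
    exact Real.rpow_le_rpow_of_exponent_le (by exact_mod_cast (show 1 ≤ q by omega)) (neg_le_neg huh)
  have hqu0 : 0 ≤ qu := (Real.rpow_pos_of_pos hq0 _).le
  -- (4) the integer inequality, over `ℝ`
  have h4 : (2 * J * (2 ^ P * 2 ^ P) * B₂ + 2 * (q + 1) * r * d : ℝ) <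
      2 * (2 * J) * (q + 1) * r * a * ρ := by
    have hcast : ((a.toNat : ℕ) : ℤ) = a := Int.toNat_of_nonneg ha0
    have hcastR : ((a.toNat : ℕ) : ℝ) = (a : ℝ) := by exact_mod_cast hcast
    have := hineq
    rw [← hcastR]
    exact_mod_cast this
  -- (5) combine: `a ρ ≤ 4^P A qu`
  have h5 : (a : ℝ) * ρ ≤ 2 ^ P * A * (2 ^ P * qu) :=
    mul_le_mul h1 h3 (Nat.cast_nonneg _) (le_trans ha0' h1)
  have hA0 : 0 ≤ A := by nlinarith
  -- the cell bound
  have hcell := LTruncation.cell_bound (fun n ↦ (v (n + 1) : ℝ)) q s₀ hu0 huh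
  have hP : ∑ n ∈ range q, (χ ((n + 1 : ℕ) : ZMod q)).re * ((n + 1 : ℕ) : ℝ) ^ (-σ) =
      ∑ n ∈ range q, (v (n + 1) : ℝ) * ((n + 1 : ℕ) : ℝ) ^ (-(s₀ + u)) := by
    refine Finset.sum_congr rfl fun n _ ↦ ?_
    rw [hv, hσ]
  rw [hP]
  refine lt_of_lt_of_le ?_ hcell
  -- final arithmetic
  have hr0 : (0 : ℝ) < r := by exact_mod_cast hr
  have hJ0 : (0 : ℝ) < J := by exact_mod_cast hJ1
  set K : ℝ := 2 * (2 * J) * (q + 1) * r with hK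
  have hK0 : 0 < K := by rw [hK]; positivity
  have hmain : (B₂ : ℝ) * (2 * J) + D * (2 * (q + 1) * r) < A * qu * K := by
    have h6 : (2 * (2 * J) * (q + 1) * r : ℝ) * (a * ρ) ≤
        (2 * (2 * J) * (q + 1) * r) * (2 ^ P * A * (2 ^ P * qu)) :=
      mul_le_mul_of_nonneg_left h5 (by positivity)
    have h7 : (2 * (q + 1) * r : ℝ) * (2 ^ P * 2 ^ P * D) ≤ (2 * (q + 1) * r) * d :=
      mul_le_mul_of_nonneg_left h2 (by positivity)
    have h8 : (2 : ℝ) ^ P * 2 ^ P * ((B₂ : ℝ) * (2 * J) + D * (2 * (q + 1) * r)) <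
        2 ^ P * 2 ^ P * (A * qu * K) := by
      rw [hK]; linarith
    exact lt_of_mul_lt_mul_left h8 (by positivity)
  have e1 : (B₂ : ℝ) / (2 * r * (q + 1 : ℕ)) = (B₂ : ℝ) * (2 * J) / K := by
    rw [hK]; push_cast; field_simp
  have e2 : 1 / ((2 * J : ℕ) : ℝ) * D = D * (2 * (q + 1) * r) / K := by
    rw [hK]; push_cast; field_simp
  rw [e1, e2, lt_sub_iff_add_lt, ← add_div, div_lt_iff₀ hK0]
  linarith

end Soundness

/-! ## Per-conductor wrappers, EVEN characters (parity test or certificate) -/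

section Wrappers

/-- **Even characters of odd conductor `q`**: either `(q−1 / q) = −1` (the character is odd — excluded)
or the certificate for `(·/q)` passes. [cite: Chua2005RealZeros, §2.2 ALGO 1] -/
theorem good_even_of_odd {q : ℕ} [NeZero q] (hq2 : q % 2 = 1) (hq1 : 1 < q) (J P : ℕ)
    (h : valOdd q (q - 1) = -1 ∨ certOK (valOdd q) q J P = true) :
    ∀ χ : DirichletCharacter ℂ q, χ.IsQuadratic → χ.IsPrimitive → χ.Even →
      ∀ σ : ℝ, 0 < σ → σ < 1 → χ.LFunction σ ≠ 0 := by
  intro χ hquad hprim heven σ hσ0 hσ1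
  have hv := re_apply_eq_valOdd (Nat.odd_iff.mpr hq2) hq1 hprim hquad
  rcases h with hpar | hcert
  · exact (not_even_of_val _ hv hpar heven).elim
  · exact lfunction_ne_zero_of_certOK hprim hquad hv hcert σ hσ0 hσ1

/-- **Even characters of conductor `4m`**, keyed on `q = 4m`. [cite: Chua2005RealZeros, §2.2 ALGO 1] -/
theorem good_even_of_four {q : ℕ} [NeZero q] (hq8 : q % 8 = 4) (hq1 : 4 < q) (J P : ℕ)
    (h : valFour (q / 4) (q - 1) = -1 ∨ certOK (valFour (q / 4)) q J P = true) :
    ∀ χ : DirichletCharacter ℂ q, χ.IsQuadratic → χ.IsPrimitive → χ.Even →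
      ∀ σ : ℝ, 0 < σ → σ < 1 → χ.LFunction σ ≠ 0 := by
  obtain ⟨m, rfl⟩ : ∃ m, q = 4 * m := ⟨q / 4, by omega⟩
  haveI : NeZero m := ⟨by omega⟩
  rw [Nat.mul_div_cancel_left m (by norm_num : 0 < 4)] at h
  intro χ hquad hprim heven σ hσ0 hσ1
  have hv := re_apply_eq_valFour (m := m) (Nat.odd_iff.mpr (by omega)) (by omega) hprim hquad
  rcases h with hpar | hcert
  · exact (not_even_of_val _ hv hpar heven).elim
  · exact lfunction_ne_zero_of_certOK hprim hquad hv hcert σ hσ0 hσ1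

/-- **Even characters of conductor `8m`**, keyed on `q = 8m`: both value patterns.
[cite: Chua2005RealZeros, §2.2 ALGO 1] -/
theorem good_even_of_eight {q : ℕ} [NeZero q] (hq16 : q % 16 = 8) (hq1 : 8 < q) (J P : ℕ)
    (hA : valEightA (q / 8) (q - 1) = -1 ∨ certOK (valEightA (q / 8)) q J P = true)
    (hB : valEightB (q / 8) (q - 1) = -1 ∨ certOK (valEightB (q / 8)) q J P = true) :
    ∀ χ : DirichletCharacter ℂ q, χ.IsQuadratic → χ.IsPrimitive → χ.Even →
      ∀ σ : ℝ, 0 < σ → σ < 1 → χ.LFunction σ ≠ 0 := by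
  obtain ⟨m, rfl⟩ : ∃ m, q = 8 * m := ⟨q / 8, by omega⟩
  haveI : NeZero m := ⟨by omega⟩
  rw [Nat.mul_div_cancel_left m (by norm_num : 0 < 8)] at hA hB
  intro χ hquad hprim heven σ hσ0 hσ1
  rcases re_apply_eq_valEight (m := m) (Nat.odd_iff.mpr (by omega)) (by omega) hprim hquad with hv | hv
  · rcases hA with hpar | hcert
    · exact (not_even_of_val _ hv hpar heven).elim
    · exact lfunction_ne_zero_of_certOK hprim hquad hv hcert σ hσ0 hσ1
  · rcases hB with hpar | hcert
    · exact (not_even_of_val _ hv hpar heven).elim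
    · exact lfunction_ne_zero_of_certOK hprim hquad hv hcert σ hσ0 hσ1

end Wrappers

end LTruncationCert

end Literature.NumberTheory.LFunctions
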